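import Mathlib
import Summits.Ventures.HodgeRepro.Tier4.Common.SettingOfData
import Summits.Ventures.HodgeRepro.Tier4.Common.MixedPlane

/-!
# Tier4/Line4/SettingPeriods — the dictionary between L1's `RTF.Setting` periods / distribution and the
`RTFData` periods / `Jc` of `Common/AdelicRTF` on `Setting.ofAdelicData` (the conjugation conventions, made exact)

Blind re-derivation cell `pub-hodge-repro`, Tier 4 «prove the step» (README §9–§10), seat t4-L4-p1 (gen 2).  Tree path
`lean/Summits/Ventures/HodgeRepro/Tier4/Line4/SettingPeriods.lean`.  Imports typer-2's `Common/SettingOfData`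
(`Setting.ofAdelicData`; hence `Line1/RTFSetting`, `Common/AdelicRTF`).

THE CONVENTIONS.  L1's toric functionals CONJUGATE their character (`S.periodT χ a = ∫_{DT} a · conj χ`,
`S.periodT' χ' a = ∫_{DT'} a · conj χ'`), its distribution does so only on the `T′` side
(`S.J χ χ' f = ∫_{DT} ∫_{DT'} K_f(t, t′) χ(t) conj χ′(t′)`); `Common/AdelicRTF`'s `periodLin W μ D χ F` is the
integral `∫_D χ · F` (un-conjugated) on the integrable functions, and `R.Jc f = P_χ (t ↦ P_{conj χ′} (t′ ↦ K_f(t, t′)))`.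
PROVED, on `S := Setting.ofAdelicData W R μ DG …` and on integrable data (the integrability DISPLAYED, since
`periodLin` is the integral only there): `periodT'_ofAdelicData_eq`: `S.periodT' (conjChar W R.chi') a =
periodLin W R.μT' R.DT' R.chi' a`; `periodT_ofAdelicData_eq`: `S.periodT (conjChar W R.chi) a = periodLin W R.μT R.DT
R.chi a`; `J_ofAdelicData_eq`: **`S.J R.chi R.chi' f = R.Jc f`** — so L1's spectral identities for `S.J R.chi R.chi'`
(t4-L1-p5's W4, `rtf_spectral`) and L4's `Jc` (decomposition A's W5, `GeometricSide`, `SpectralKernelFamily`) are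
about the SAME number, and the Riesz functional of `Line4/RieszOnKType` (`P ψ := periodLin W R.μT' R.DT' R.chi' (ψ|_{T′})`)
is `S.periodT' (conjChar W R.chi')`.

HC_CM is NOT proved by anyone in this repository.
-/

set_option autoImplicit false

noncomputable section

namespace Summit.Ventures.HodgeRepro.Tier4.Line4

open Summit.Ventures.HodgeRepro.Tier4.Common Summit.Ventures.HodgeRepro.Tier4.Line1 MeasureTheory NumberField

variable {k : Type} [Field k] [NumberField k] (W : PlaneData k)
  [MeasurableSpace (GA W)] [BorelSpace (GA W)] (R : RTFData W) (μ : Measure (GA W))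
  [μ.IsHaarMeasure] [R.μT.IsHaarMeasure] [R.μT'.IsHaarMeasure] (DG : Set (GA W))
  (fdG : IsFundamentalDomain (rationalPoints W) DG μ) (compG : IsCompact (closure DG))
  (compT : IsCompact (closure R.DT)) (compT' : IsCompact (closure R.DT'))

/-- **The `T′`-functional of the setting with the conjugate character is `periodLin … R.chi'`** (on integrable data). -/
theorem periodT'_ofAdelicData_eq (a : torusT' W → ℂ)
    (hint : Integrable (fun t => R.chi' t * a t) (R.μT'.restrict R.DT')) :
    (Setting.ofAdelicData W R μ DG fdG compG compT compT').periodT' (conjChar W R.chi') a =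
      periodLin W R.μT' R.DT' R.chi' a := by
  rw [periodLin_eq_integral W _ _ _ hint]
  simp only [RTF.Setting.periodT', Setting.ofAdelicData, conjChar, Complex.conj_conj]
  congr 1
  funext t
  ring

/-- **The `T`-functional of the setting with the conjugate character is `periodLin … R.chi`** (on integrable data). -/
theorem periodT_ofAdelicData_eq (a : torusT W → ℂ)
    (hint : Integrable (fun t => R.chi t * a t) (R.μT.restrict R.DT)) :
    (Setting.ofAdelicData W R μ DG fdG compG compT compT').periodT (conjChar W R.chi) a =
      periodLin W R.μT R.DT R.chi a := by
  rw [periodLin_eq_integral W _ _ _ hint]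
  simp only [RTF.Setting.periodT, Setting.ofAdelicData, conjChar, Complex.conj_conj]
  congr 1
  funext t
  ring

/-- **The setting's distribution at `(χ, χ′)` is `Jc`**: `S.J R.chi R.chi' f = R.Jc f` (the inner and outer
integrability DISPLAYED). -/
theorem J_ofAdelicData_eq (f : GA W → ℂ)
    (hinner : ∀ t : torusT W,
      Integrable (fun t' : torusT' W => R.chi'conj t' * kernel W f (t : GA W) (t' : GA W)) (R.μT'.restrict R.DT'))
    (houter : Integrable (fun t : torusT W =>
      R.chi t * periodLin W R.μT' R.DT' R.chi'conj (fun t' : torusT' W => kernel W f (t : GA W) (t' : GA W)))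
      (R.μT.restrict R.DT)) :
    (Setting.ofAdelicData W R μ DG fdG compG compT compT').J R.chi R.chi' f = R.Jc f := by
  unfold RTFData.Jc RTFData.periodT RTFData.periodT'conj
  rw [periodLin_eq_integral W _ _ _ houter]
  simp only [RTF.Setting.J, Setting.ofAdelicData]
  congr 1
  funext t
  rw [periodLin_eq_integral W _ _ _ (hinner t), ← integral_const_mul]
  congr 1
  funext t'
  simp only [RTF.Setting.kernel, RTFData.chi'conj, Summit.Ventures.HodgeRepro.Tier4.Common.kernel]
  ring

end Summit.Ventures.HodgeRepro.Tier4.Line4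

end
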